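/-
Copyright (c) 2026 the pub-hodgecm-mathlib formalisation cell (harness21).  Prover seat hodgecm-mathlib-LH4-p02 (g12): STAGE 1a «(D-RAM) FOUR-FRAME» road, unit
U3 (S)-side, TARGET G of LH4-p11 (g0)'s DATUM §4–§6 list (22:14:54Z): the splitting of a sub-building vertex; 2026-09-03.
-/
import Summits.HodgeConjecture.HodgeConjecture.Theorems.F0P3cDyRamDiagonalSubBuildingSlot   -- ★ p855155 (LH4-p10 (g0)): `single_mem_and_v_le_of_isVertexLattice_diagonal` (`e_i ∈ M`, `|x_i| ≤ 1` on `M`)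
import HarnessLib

/-!
# Crux `H413`, line LH4 «(D-RAM) FOUR-FRAME», unit U3 (S)-side: A VERTEX OF THE SUB-BUILDING `B_i` SPLITS AS `𝒪e_i ⊕ (M ∩ e_i^⊥)`

Cell `hodgecm-mathlib` (D-0151), FLOOR 0, crux item H413 = `stmt-HodgeConjecture-24833`, route of record `HCCMUnconditional`; squad F0∕P3c∕LH4 Track A; TARGET G
of LH4-p11 (g0)'s (S)-side intermediate targets toward `stub_U3_stableLaw_RU` (signature signed by p11, 22:14:54Z, typed here VERBATIM).  THEOREMS ONLY (no `def`,
no instance, no notation, no `sorry`, default heartbeats); generic valued field, `t`-uniform, `κ`-free; lane `--supports stmt-HodgeConjecture-24833 --as helper`.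

WHAT IS PROVED.  `eq_span_single_sup_inf_ker_of_single_mem`: in the diagonal unimodular model, a type-`t` vertex lattice `M` stable under the `i`-th coordinate cut-off
(`x ∈ M ⇒ x_i·e_i ∈ M`) splits: `M = 𝒪·e_i ⊔ (M ⊓ ker proj_i)`, the two summands are disjoint, and `x_i·e_i ∈ 𝒪·e_i` for every `x ∈ M`.  From ★ p855155 (`e_i ∈ M` and
`|x_i| ≤ 1` on `M`): `x = x_i·e_i + (x − x_i·e_i)` with `x_i ∈ 𝒪` and the second summand in `M` with vanishing `i`-th coordinate; an element of `𝒪·e_i` with vanishing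
`i`-th coordinate is `0`.  MEANING (DATUM §6): a `B_i`-vertex is `𝒪e_i ⊕ M′` with `M′ ⊂ e_i^⊥` the plane lattice carrying the type — the entry to the plane census.

HONEST LABEL.  Count-neutral helper (`--supports 24833`) for the (S)-side payers of U3.  (D-RAM) verdict of record PRINT [LanglandsShelstad1989 Thm. p. 484 ∕
Rogawski1990 Prop. 4.9.1 (a)] ∕ XL; `HC_CM` is proved only modulo the 7 printed citations (2 remaining: hLiu418 = `stmt-HodgeConjecture-24832`, h413 =
`stmt-HodgeConjecture-24833`) until rung 0 closes.

## References
* [BruhatTits1972] F. Bruhat, J. Tits, *Groupes réductifs sur un corps local I*, Publ. Math. IHÉS 41 (1972), §10 (sub-buildings of Levi subgroups).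
* [Serre1980Trees] J.-P. Serre, *Trees* (1980), Ch. II §1.1 (lattices; the tree of a plane).
* [Kottwitz1986BaseChangeUnits] R. Kottwitz, *Base change for unit elements of Hecke algebras*, Compositio Math. 60 (1986), §1 pp. 240–241.
-/

noncomputable section

namespace Summit.HodgeConjecture.HodgeConjecture.Cruxes.H413.F0P3cDyRamDiagonalSubBuildingSplit

open Matrix
open Literature.NumberTheory.Automorphic Literature.NumberTheory.Automorphic.HermitianLattice
open Literature.NumberTheory.Automorphic.UnitaryLatticeTree
open Summit.HodgeConjecture.HodgeConjecture.Cruxes.H413.F0P3cDyRamDiagonalSubBuildingSlot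
open scoped Valued WithZero Matrix MatrixGroups

/-- **A `B_i`-VERTEX SPLITS AS `𝒪e_i ⊕ (M ∩ e_i^⊥)`** (TARGET G of LH4-p11 (g0)'s (S)-side list, VERBATIM): for a type-`t` vertex lattice `M` of the diagonal unimodular
model with `x_i·e_i ∈ M` for all `x ∈ M`: `M = 𝒪·e_i ⊔ (M ⊓ ker proj_i)`, the summands are disjoint, and `x_i·e_i ∈ 𝒪·e_i` on `M` (★ p855155: `e_i ∈ M`, `|x_i| ≤ 1`).
[cite: BruhatTits1972, §10] [cite: Serre1980Trees, II §1.1] [cite: Kottwitz1986BaseChangeUnits, §1 pp. 240–241] -/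
theorem eq_span_single_sup_inf_ker_of_single_mem {K : Type*} [Field K] [Valued K ℤᵐ⁰] {σ : K →+* K} (hvσ : ∀ a, Valued.v (σ a) = Valued.v a) {ϖ : K}
    (hϖ : Valued.v ϖ = WithZero.exp (-1 : ℤ)) {d : Fin 3 → K} (hd : ∀ i, Valued.v (d i) = 1) {t : ℕ} {M : Submodule 𝒪[K] (Fin 3 → K)}
    (hM : IsVertexLattice σ ϖ (Matrix.diagonal d) t M) (i : Fin 3) (hi : ∀ x ∈ M, (Pi.single i (x i) : Fin 3 → K) ∈ M) :
    M = (𝒪[K] ∙ (Pi.single i 1 : Fin 3 → K)) ⊔ (M ⊓ LinearMap.ker ((LinearMap.proj i : (Fin 3 → K) →ₗ[K] K).restrictScalars 𝒪[K])) ∧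
    Disjoint (𝒪[K] ∙ (Pi.single i 1 : Fin 3 → K)) (M ⊓ LinearMap.ker ((LinearMap.proj i : (Fin 3 → K) →ₗ[K] K).restrictScalars 𝒪[K])) ∧
    ∀ x ∈ M, x i • (Pi.single i 1 : Fin 3 → K) ∈ 𝒪[K] ∙ (Pi.single i 1 : Fin 3 → K) := by
  obtain ⟨he, hint⟩ := single_mem_and_v_le_of_isVertexLattice_diagonal hvσ hϖ hd hM i hi
  -- `x_i·e_i ∈ 𝒪·e_i` (the coefficient `x_i` is integral)
  have h3 : ∀ x ∈ M, x i • (Pi.single i 1 : Fin 3 → K) ∈ 𝒪[K] ∙ (Pi.single i 1 : Fin 3 → K) := fun x hx =>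
    Submodule.mem_span_singleton.2 ⟨⟨x i, hint x hx⟩, rfl⟩
  -- `x_i·e_i = x_i e_i` as a coordinate vector
  have hsingle : ∀ x : Fin 3 → K, x i • (Pi.single i 1 : Fin 3 → K) = Pi.single i (x i) := fun x => by
    rw [← Pi.single_smul, smul_eq_mul, mul_one]
  refine ⟨le_antisymm (fun x hx => ?_) (sup_le ((Submodule.span_singleton_le_iff_mem _ _).2 he) inf_le_left), ?_, h3⟩
  · -- `x = x_i e_i + (x − x_i e_i)`
    rw [show x = x i • (Pi.single i 1 : Fin 3 → K) + (x - x i • (Pi.single i 1 : Fin 3 → K)) from (add_sub_cancel _ _).symm]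
    refine Submodule.add_mem_sup (h3 x hx) (Submodule.mem_inf.2 ⟨?_, ?_⟩)
    · rw [hsingle]; exact M.sub_mem hx (hi x hx)
    · rw [LinearMap.mem_ker, LinearMap.restrictScalars_apply, map_sub, LinearMap.proj_apply, LinearMap.proj_apply, hsingle, Pi.single_eq_same, sub_self]
  · -- disjointness: an element of `𝒪·e_i` with vanishing `i`-th coordinate is `0`
    rw [Submodule.disjoint_def]
    intro x hx hx'
    obtain ⟨a, rfl⟩ := Submodule.mem_span_singleton.1 hx
    have h0 := (Submodule.mem_inf.1 hx').2
    rw [LinearMap.mem_ker, LinearMap.restrictScalars_apply, LinearMap.proj_apply] at h0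
    change ((a : K) • (Pi.single i 1 : Fin 3 → K)) i = 0 at h0
    rw [Pi.smul_apply, Pi.single_eq_same, smul_eq_mul, mul_one] at h0
    change (a : K) • (Pi.single i 1 : Fin 3 → K) = 0
    rw [h0, zero_smul]

end Summit.HodgeConjecture.HodgeConjecture.Cruxes.H413.F0P3cDyRamDiagonalSubBuildingSplit

end
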